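import Summits.CriticalPhenomena.PercolationContinuityZ3.Theorems.PercNearOneGluingNoHeavyPcintKernZ6B4Defs
import HarnessLib

/-!
# PCINT lane, kernel check 1/4 of the B3r window certificate `d = 6`, memory 4 (3-step windows, 1728 codes): codes `0 ≤ c < 432`

Cell `prim-pcint`, seat `prim-pcint-2` (gen 2).  Collatz–Wielandt rows `10^5 · row ≤ 99999 · DEN · v` for the window codes in
`[0, 432)`, by `decide +kernel` in chunks of `54` codes (natural-number arithmetic only; `maxHeartbeats 0`).
Does NOT build on p205010.
-/

namespace Summit.CriticalPhenomena.PercolationContinuityZ3.Theorems.Pcint.Z6B4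

set_option maxHeartbeats 0 in
/-- Rows `0 ≤ c < 54` of the certificate hold. [folklore] -/
theorem chk_0_54 : WinK.allRange (WinK.rowOKB 6 2 923 10043 9958 99999 tbl 90539) 0 54 = true := by decide +kernel

set_option maxHeartbeats 0 in
/-- Rows `54 ≤ c < 108` of the certificate hold. [folklore] -/
theorem chk_54_108 : WinK.allRange (WinK.rowOKB 6 2 923 10043 9958 99999 tbl 90539) 54 108 = true := by decide +kernel

set_option maxHeartbeats 0 in
/-- Rows `108 ≤ c < 162` of the certificate hold. [folklore] -/
theorem chk_108_162 : WinK.allRange (WinK.rowOKB 6 2 923 10043 9958 99999 tbl 90539) 108 162 = true := by decide +kernel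

set_option maxHeartbeats 0 in
/-- Rows `162 ≤ c < 216` of the certificate hold. [folklore] -/
theorem chk_162_216 : WinK.allRange (WinK.rowOKB 6 2 923 10043 9958 99999 tbl 90539) 162 216 = true := by decide +kernel

set_option maxHeartbeats 0 in
/-- Rows `216 ≤ c < 270` of the certificate hold. [folklore] -/
theorem chk_216_270 : WinK.allRange (WinK.rowOKB 6 2 923 10043 9958 99999 tbl 90539) 216 270 = true := by decide +kernel

set_option maxHeartbeats 0 in
/-- Rows `270 ≤ c < 324` of the certificate hold. [folklore] -/
theorem chk_270_324 : WinK.allRange (WinK.rowOKB 6 2 923 10043 9958 99999 tbl 90539) 270 324 = true := by decide +kernel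

set_option maxHeartbeats 0 in
/-- Rows `324 ≤ c < 378` of the certificate hold. [folklore] -/
theorem chk_324_378 : WinK.allRange (WinK.rowOKB 6 2 923 10043 9958 99999 tbl 90539) 324 378 = true := by decide +kernel

set_option maxHeartbeats 0 in
/-- Rows `378 ≤ c < 432` of the certificate hold. [folklore] -/
theorem chk_378_432 : WinK.allRange (WinK.rowOKB 6 2 923 10043 9958 99999 tbl 90539) 378 432 = true := by decide +kernel

/-- Rows `0 ≤ c < 432` of the certificate hold. [folklore] -/
theorem chkFile_1 : WinK.allRange (WinK.rowOKB 6 2 923 10043 9958 99999 tbl 90539) 0 432 = true :=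
  chk_split (chk_split (chk_split (chk_split (chk_split (chk_split (chk_split chk_0_54 chk_54_108) chk_108_162) chk_162_216) chk_216_270) chk_270_324) chk_324_378) chk_378_432

end Summit.CriticalPhenomena.PercolationContinuityZ3.Theorems.Pcint.Z6B4
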